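import Literature.MathematicalPhysics.KineticTheory.LanfordCollisionEstimates
import HarnessLib

/-!
# Dispersive (travelling-Maxwellian) estimates for the hard-sphere collision operator

Topic: MathematicalPhysics / KineticTheory. Second layer of the existence half of the named fact
`Literature.MathematicalPhysics.KineticTheory.illner_pulvirenti` (global validity of the
Boltzmann equation for a rare gas cloud in all space; Cercignani–Illner–Pulvirenti 1994
Thm 4.5.1, Thm 5.2.2; Illner–Shinbrot 1984).

The global-in-time perturbation-of-vacuum theory replaces the Gaussian velocity weight
`e^{-β|v|²/2}` of the local theory (`LanfordCollisionEstimates`) by the *travelling Maxwellian*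

  `W_{y,τ}(w) = e^{-(β/2)(|y - τ w|² + |w|²)}`      (CIP 1994 (5.4)–(5.5); Illner–Shinbrot 1984 §2),

the value at time `τ` and position `y` of the free transport of `e^{-(β/2)(|x|² + |w|²)}`. The
product `W_{y,τ}(v') W_{y,τ}(v_*')` is a collision invariant (conservation of momentum AND
energy: `exp_dispersive_collide_mul`), so the mechanism of the local estimates goes through with
the dispersive weight, except that the kernel `((v - v_*)·ω)_+ ≤ |v - v_*|` is kept inside the
`dv_*` integral — it is compensated later by the time integration along characteristics
(`IllnerShinbrotLineBound`), not by a loss of weight: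

* `abs_absCollisionIntegrand_sub_le_dispersive` — for velocity densities `p, q` with
  `|p|, |q| ≤ R W_{y,τ}` and `|p - q| ≤ D W_{y,τ}`, the sign-corrected integrands
  `B (|p'| |p_*'| - p |p_*|)` (Kaniel–Shinbrot) differ by at most
  `4 R D |v - v_*| W_{y,τ}(v) W_{y,τ}(v_*)`, and each is bounded by
  `2 R² |v - v_*| W_{y,τ}(v) W_{y,τ}(v_*)` (`abs_absCollisionIntegrand_le_dispersive`);
* `absCollision_lipschitz_dispersive`, `absCollision_bound_dispersive` — the integrated forms
  `|Q̃(p)(v) - Q̃(q)(v)| ≤ 4 |S^{d-1}| R D · W_{y,τ}(v) ∫ |v - w| W_{y,τ}(w) dw` and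
  `|Q̃(p)(v)| ≤ 4 |S^{d-1}| R² · W_{y,τ}(v) ∫ |v - w| W_{y,τ}(w) dw`
  (via `abs_integral_integral_sub_le`, `integrable_inner_outer`);
* `integrable_norm_sub_mul_dispersive` — `w ↦ |v - w| W_{y,τ}(w)` is integrable.

Theorems only; no definitions (the sign-corrected operator is written out, as in
`LanfordPicard`). Velocity space: a finite-dimensional real inner product space `E`.

## References

* C. Cercignani, R. Illner, M. Pulvirenti, *The Mathematical Theory of Dilute Gases*, Applied
  Mathematical Sciences 106, Springer (1994), §4.5 (proof of Thm 4.5.1, Step 3, (5.1)–(5.9),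
  pp. 88–90), §5.2 (Kaniel–Shinbrot scheme, (2.1)–(2.4), pp. 136–137; Thm 5.2.2).
* R. Illner, M. Shinbrot, *The Boltzmann equation: global existence for a rare gas in an
  infinite vacuum*, Comm. Math. Phys. 95 (1984) 217–226.
* S. Kaniel, M. Shinbrot, *The Boltzmann equation. I. Uniqueness and local existence*,
  Comm. Math. Phys. 58 (1978) 65–84.
-/

open MeasureTheory Metric Real Set Filter Topology
open scoped InnerProductSpace ENNReal
open Literature.Analysis.FluidPDE

namespace Literature.MathematicalPhysics.KineticTheory

noncomputable section

/-! ## The travelling Maxwellian is a collision invariant -/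

section Invariance

variable {E : Type*} [NormedAddCommGroup E] [InnerProductSpace ℝ E]

/-- Conservation of `|y - τ v|² + |y - τ v_*|²` in an elastic collision (it equals
`2|y|² - 2τ ⟨y, v + v_*⟩ + τ² (|v|² + |v_*|²)`, a function of momentum and energy;
CIP 1994 §4.5 (5.5)). [cite: CIP1994, §4.5 (5.5)] -/
theorem norm_sq_sub_smul_collide_add (y : E) (τ : ℝ) (ω : sphere (0 : E) 1) (p : E × E) :
    ‖y - τ • (collide ω p).1‖ ^ 2 + ‖y - τ • (collide ω p).2‖ ^ 2 =
      ‖y - τ • p.1‖ ^ 2 + ‖y - τ • p.2‖ ^ 2 := by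
  have hm := collide_fst_add_collide_snd ω p
  have he := norm_sq_collide_fst_add_norm_sq_collide_snd ω p
  have expand : ∀ u : E, ‖y - τ • u‖ ^ 2 = ‖y‖ ^ 2 - 2 * τ * ⟪y, u⟫_ℝ + τ ^ 2 * ‖u‖ ^ 2 :=
    fun u => by
    rw [norm_sub_sq_real, real_inner_smul_right, norm_smul, mul_pow, Real.norm_eq_abs, sq_abs]
    ring
  have hi : ⟪y, (collide ω p).1⟫_ℝ + ⟪y, (collide ω p).2⟫_ℝ = ⟪y, p.1⟫_ℝ + ⟪y, p.2⟫_ℝ := by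
    rw [← inner_add_right, ← inner_add_right, hm]
  rw [expand, expand, expand p.1, expand p.2]
  linear_combination (-2 * τ) * hi + τ ^ 2 * he

/-- **The travelling Maxwellian is a collision invariant**:
`W(v') W(v_*') = W(v) W(v_*)` for `W(u) = e^{-(β/2)(|y - τu|² + |u|²)}` (conservation of momentum
and energy; CIP 1994 §4.5 (5.4)–(5.5), Illner–Shinbrot 1984 §2). [cite: CIP1994, §4.5 (5.4)–(5.5)] -/
theorem exp_dispersive_collide_mul (β : ℝ) (y : E) (τ : ℝ) (ω : sphere (0 : E) 1) (p : E × E) :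
    exp (-(β / 2) * (‖y - τ • (collide ω p).1‖ ^ 2 + ‖(collide ω p).1‖ ^ 2)) *
        exp (-(β / 2) * (‖y - τ • (collide ω p).2‖ ^ 2 + ‖(collide ω p).2‖ ^ 2)) =
      exp (-(β / 2) * (‖y - τ • p.1‖ ^ 2 + ‖p.1‖ ^ 2)) *
        exp (-(β / 2) * (‖y - τ • p.2‖ ^ 2 + ‖p.2‖ ^ 2)) := by
  rw [← exp_add, ← exp_add]
  congr 1
  have h1 := norm_sq_sub_smul_collide_add y τ ω p
  have h2 := norm_sq_collide_fst_add_norm_sq_collide_snd ω p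
  linear_combination (-(β / 2)) * h1 + (-(β / 2)) * h2

/-- `((v - v_*)·ω)_+ ≤ |v - v_*|`. [folklore] -/
theorem hardSphereKernel_le_norm_sub (v w : E) (ω : sphere (0 : E) 1) :
    hardSphereKernel (v, w) ω ≤ ‖v - w‖ := by
  refine max_le ?_ (norm_nonneg _)
  calc ⟪v - w, (ω : E)⟫_ℝ ≤ ‖v - w‖ * ‖(ω : E)‖ := real_inner_le_norm _ _
    _ = ‖v - w‖ := by rw [norm_eq_of_mem_sphere ω, mul_one]

/-! ## Pointwise bounds on the sign-corrected collision integrand -/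

/-- **Dispersive Lipschitz bound for the sign-corrected integrand.** If
`|p|, |q| ≤ R W` and `|p - q| ≤ D W` with `W(u) = e^{-(β/2)(|y - τu|² + |u|²)}`, then
`|B (|p'| |p_*'| - p |p_*|) - B (|q'| |q_*'| - q |q_*|)| ≤ 4 R D |v - v_*| W(v) W(v_*)` for the
hard-sphere kernel `B = ((v - v_*)·ω)_+` (`|ab - a'b'| ≤ |a - a'||b| + |a'||b - b'|`, the
collision invariance `exp_dispersive_collide_mul`, and `B ≤ |v - v_*|`; CIP 1994 §4.5 (5.3)–(5.5)).
[cite: CIP1994, §4.5 (5.3)–(5.5)] -/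
theorem abs_absCollisionIntegrand_sub_le_dispersive {p q : E → ℝ} {R D β : ℝ} {y : E} {τ : ℝ}
    (hR : 0 ≤ R) (hD : 0 ≤ D)
    (hp : ∀ u, |p u| ≤ R * exp (-(β / 2) * (‖y - τ • u‖ ^ 2 + ‖u‖ ^ 2)))
    (hq : ∀ u, |q u| ≤ R * exp (-(β / 2) * (‖y - τ • u‖ ^ 2 + ‖u‖ ^ 2)))
    (hpq : ∀ u, |p u - q u| ≤ D * exp (-(β / 2) * (‖y - τ • u‖ ^ 2 + ‖u‖ ^ 2)))
    (v w : E) (ω : sphere (0 : E) 1) :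
    |hardSphereKernel (v, w) ω *
          (|p (collide ω (v, w)).1| * |p (collide ω (v, w)).2| - p v * |p w|) -
        hardSphereKernel (v, w) ω *
          (|q (collide ω (v, w)).1| * |q (collide ω (v, w)).2| - q v * |q w|)| ≤
      4 * R * D * ‖v - w‖ * (exp (-(β / 2) * (‖y - τ • v‖ ^ 2 + ‖v‖ ^ 2)) *
        exp (-(β / 2) * (‖y - τ • w‖ ^ 2 + ‖w‖ ^ 2))) := by
  set G : E → ℝ := fun u => exp (-(β / 2) * (‖y - τ • u‖ ^ 2 + ‖u‖ ^ 2)) with hG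
  have hG0 : ∀ u, 0 ≤ G u := fun u => (exp_pos _).le
  have hGG : G (collide ω (v, w)).1 * G (collide ω (v, w)).2 = G v * G w :=
    exp_dispersive_collide_mul β y τ ω (v, w)
  have hp' : ∀ u, |p u| ≤ R * G u := hp
  have hq' : ∀ u, |q u| ≤ R * G u := hq
  have habs_p : ∀ u, |(|p u|)| ≤ R * G u := fun u => by rw [abs_abs]; exact hp u
  have habs_q : ∀ u, |(|q u|)| ≤ R * G u := fun u => by rw [abs_abs]; exact hq u
  have habs_pq : ∀ u, |(|p u|) - (|q u|)| ≤ D * G u := fun u =>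
    (abs_abs_sub_abs_le_abs_sub _ _).trans (hpq u)
  have hdiff : ∀ {a a' b b' : ℝ} {x z : E}, |a'| ≤ R * G x → |b| ≤ R * G z →
      |a - a'| ≤ D * G x → |b - b'| ≤ D * G z →
      |a * b - a' * b'| ≤ 2 * R * D * (G x * G z) := by
    intro a a' b b' x z ha' hb hda hdb
    exact abs_mul_sub_mul_le_of_bounds (hG0 x) hR hD ha' hb hda hdb
  have h1 := hdiff (habs_q (collide ω (v, w)).1) (habs_p (collide ω (v, w)).2)
    (habs_pq (collide ω (v, w)).1) (habs_pq (collide ω (v, w)).2)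
  have h2 := hdiff (hq' v) (habs_p w) (hpq v) (habs_pq w)
  rw [hGG] at h1
  have hk0 : 0 ≤ hardSphereKernel (v, w) ω := le_max_right _ _
  have hk := hardSphereKernel_le_norm_sub v w ω
  have e : hardSphereKernel (v, w) ω *
        (|p (collide ω (v, w)).1| * |p (collide ω (v, w)).2| - p v * |p w|) -
      hardSphereKernel (v, w) ω *
        (|q (collide ω (v, w)).1| * |q (collide ω (v, w)).2| - q v * |q w|) =
      hardSphereKernel (v, w) ω *
        ((|p (collide ω (v, w)).1| * |p (collide ω (v, w)).2| -
            |q (collide ω (v, w)).1| * |q (collide ω (v, w)).2|) -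
          (p v * |p w| - q v * |q w|)) := by ring
  rw [e, abs_mul, abs_of_nonneg hk0]
  calc hardSphereKernel (v, w) ω *
        |(|p (collide ω (v, w)).1| * |p (collide ω (v, w)).2| -
            |q (collide ω (v, w)).1| * |q (collide ω (v, w)).2|) -
          (p v * |p w| - q v * |q w|)|
      ≤ ‖v - w‖ * (2 * R * D * (G v * G w) + 2 * R * D * (G v * G w)) :=
        mul_le_mul hk ((abs_sub _ _).trans (add_le_add h1 h2)) (abs_nonneg _) (norm_nonneg _)
    _ = 4 * R * D * ‖v - w‖ * (G v * G w) := by ring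

/-- **Dispersive bound for the sign-corrected integrand** (the case `q = 0`, `D = R` of
`abs_absCollisionIntegrand_sub_le_dispersive`, with the better constant obtained directly): if
`|p| ≤ R W`, `W(u) = e^{-(β/2)(|y - τu|² + |u|²)}`, then
`|B (|p'| |p_*'| - p |p_*|)| ≤ 2 R² |v - v_*| W(v) W(v_*)` (CIP 1994 §4.5 (5.3)–(5.5)).
[cite: CIP1994, §4.5 (5.3)–(5.5)] -/
theorem abs_absCollisionIntegrand_le_dispersive {p : E → ℝ} {R β : ℝ} {y : E} {τ : ℝ}
    (hp : ∀ u, |p u| ≤ R * exp (-(β / 2) * (‖y - τ • u‖ ^ 2 + ‖u‖ ^ 2)))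
    (v w : E) (ω : sphere (0 : E) 1) :
    |hardSphereKernel (v, w) ω *
        (|p (collide ω (v, w)).1| * |p (collide ω (v, w)).2| - p v * |p w|)| ≤
      2 * R ^ 2 * ‖v - w‖ * (exp (-(β / 2) * (‖y - τ • v‖ ^ 2 + ‖v‖ ^ 2)) *
        exp (-(β / 2) * (‖y - τ • w‖ ^ 2 + ‖w‖ ^ 2))) := by
  set G : E → ℝ := fun u => exp (-(β / 2) * (‖y - τ • u‖ ^ 2 + ‖u‖ ^ 2)) with hG
  have hGG : G (collide ω (v, w)).1 * G (collide ω (v, w)).2 = G v * G w :=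
    exp_dispersive_collide_mul β y τ ω (v, w)
  have hp' : ∀ u, |p u| ≤ R * G u := hp
  have hprod : ∀ {a b : ℝ} {x z : E}, |a| ≤ R * G x → |b| ≤ R * G z →
      |a| * |b| ≤ R ^ 2 * (G x * G z) := by
    intro a b x z ha hb
    calc |a| * |b| ≤ (R * G x) * (R * G z) :=
          mul_le_mul ha hb (abs_nonneg _) ((abs_nonneg _).trans ha)
      _ = R ^ 2 * (G x * G z) := by ring
  have hgain : |(|p (collide ω (v, w)).1| * |p (collide ω (v, w)).2|)| ≤ R ^ 2 * (G v * G w) := by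
    rw [abs_of_nonneg (by positivity), ← hGG]
    exact hprod (hp' _) (hp' _)
  have hloss : |p v * (|p w|)| ≤ R ^ 2 * (G v * G w) := by
    rw [abs_mul, abs_abs]
    exact hprod (hp' _) (hp' _)
  have hk0 : 0 ≤ hardSphereKernel (v, w) ω := le_max_right _ _
  have hk := hardSphereKernel_le_norm_sub v w ω
  rw [abs_mul, abs_of_nonneg hk0]
  calc hardSphereKernel (v, w) ω *
        |(|p (collide ω (v, w)).1| * |p (collide ω (v, w)).2| - p v * |p w|)|
      ≤ ‖v - w‖ * (R ^ 2 * (G v * G w) + R ^ 2 * (G v * G w)) :=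
        mul_le_mul hk ((abs_sub _ _).trans (add_le_add hgain hloss)) (abs_nonneg _) (norm_nonneg _)
    _ = 2 * R ^ 2 * ‖v - w‖ * (G v * G w) := by ring

end Invariance

/-! ## Integrated bounds -/

section Integrated

variable {E : Type*} [NormedAddCommGroup E] [InnerProductSpace ℝ E] [FiniteDimensional ℝ E]
  [MeasurableSpace E] [BorelSpace E]

/-- `w ↦ |v - w| e^{-(β/2)(|y - τw|² + |w|²)}` is integrable for `β > 0` (continuous, dominated
by `(1 + |v|)(1 + |w|) e^{-(β/2)|w|²}`). [folklore] -/
theorem integrable_norm_sub_mul_dispersive {β : ℝ} (hβ : 0 < β) (y v : E) (τ : ℝ) :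
    Integrable fun w : E => ‖v - w‖ * exp (-(β / 2) * (‖y - τ • w‖ ^ 2 + ‖w‖ ^ 2)) := by
  set ψ : E → ℝ := fun w => (1 + ‖w‖) * exp (-(β / 2) * ‖w‖ ^ 2) with hψ
  have hψi : Integrable ψ := integrable_one_add_norm_mul_exp hβ
  refine (hψi.const_mul (1 + ‖v‖)).mono' ?_ (Eventually.of_forall fun w => ?_)
  · exact (by fun_prop : Continuous fun w : E =>
      ‖v - w‖ * exp (-(β / 2) * (‖y - τ • w‖ ^ 2 + ‖w‖ ^ 2))).aestronglyMeasurable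
  · rw [Real.norm_of_nonneg (by positivity)]
    have h1 : ‖v - w‖ ≤ (1 + ‖v‖) * (1 + ‖w‖) := by
      have := norm_sub_le v w
      nlinarith [norm_nonneg v, norm_nonneg w]
    have h2 : exp (-(β / 2) * (‖y - τ • w‖ ^ 2 + ‖w‖ ^ 2)) ≤ exp (-(β / 2) * ‖w‖ ^ 2) := by
      refine exp_le_exp.2 ?_
      nlinarith [sq_nonneg ‖y - τ • w‖]
    calc ‖v - w‖ * exp (-(β / 2) * (‖y - τ • w‖ ^ 2 + ‖w‖ ^ 2))
        ≤ ((1 + ‖v‖) * (1 + ‖w‖)) * exp (-(β / 2) * ‖w‖ ^ 2) :=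
          mul_le_mul h1 h2 (exp_pos _).le (by positivity)
      _ = (1 + ‖v‖) * ψ w := by simp only [hψ]; ring

/-- **Dispersive Lipschitz estimate for the sign-corrected hard-sphere collision operator**
(CIP 1994 §4.5, Step 3, (5.1)–(5.5); Illner–Shinbrot 1984 §2; the order structure is that of the
Kaniel–Shinbrot scheme, CIP 1994 §5.2 (2.1)–(2.2)). For measurable velocity densities `p, q` with
`|p|, |q| ≤ R W`, `|p - q| ≤ D W`, `W(u) = e^{-(β/2)(|y - τu|² + |u|²)}`, `β > 0`:
`|Q̃(p)(v) - Q̃(q)(v)| ≤ 4 |S^{d-1}| R D · W(v) ∫ |v - w| W(w) dw`, where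
`Q̃(p)(v) = ∫∫ ((v - v_*)·ω)_+ (|p'| |p_*'| - p |p_*|) dω dv_*`. The factor `|v - w|` is kept
under the integral: its time integral along characteristics is what stays bounded
(`intervalIntegral_dispersiveMajorant_le`). [cite: CIP1994, §4.5 (5.1)–(5.5)] -/
theorem absCollision_lipschitz_dispersive {β : ℝ} (hβ : 0 < β) {y : E} {τ : ℝ}
    {p q : E → ℝ} (hpm : Measurable p) (hqm : Measurable q) {R D : ℝ} (hR : 0 ≤ R) (hD : 0 ≤ D)
    (hp : ∀ u, |p u| ≤ R * exp (-(β / 2) * (‖y - τ • u‖ ^ 2 + ‖u‖ ^ 2)))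
    (hq : ∀ u, |q u| ≤ R * exp (-(β / 2) * (‖y - τ • u‖ ^ 2 + ‖u‖ ^ 2)))
    (hpq : ∀ u, |p u - q u| ≤ D * exp (-(β / 2) * (‖y - τ • u‖ ^ 2 + ‖u‖ ^ 2))) (v : E) :
    |(∫ w, ∫ ω, hardSphereKernel (v, w) ω *
          (|p (collide ω (v, w)).1| * |p (collide ω (v, w)).2| - p v * |p w|) ∂sphereMeasure) -
        ∫ w, ∫ ω, hardSphereKernel (v, w) ω *
          (|q (collide ω (v, w)).1| * |q (collide ω (v, w)).2| - q v * |q w|) ∂sphereMeasure| ≤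
      4 * (sphereMeasure : Measure (sphere (0 : E) 1)).real univ * R * D *
        exp (-(β / 2) * (‖y - τ • v‖ ^ 2 + ‖v‖ ^ 2)) *
        ∫ w, ‖v - w‖ * exp (-(β / 2) * (‖y - τ • w‖ ^ 2 + ‖w‖ ^ 2)) := by
  haveI := isFiniteMeasure_sphereMeasure (E := E)
  set S : ℝ := (sphereMeasure : Measure (sphere (0 : E) 1)).real univ with hS
  set G : E → ℝ := fun u => exp (-(β / 2) * (‖y - τ • u‖ ^ 2 + ‖u‖ ^ 2)) with hG
  set g : E → ℝ := fun w => ‖v - w‖ * G w with hg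
  have hG0 : ∀ u, 0 ≤ G u := fun u => (exp_pos _).le
  have hgi : Integrable g := integrable_norm_sub_mul_dispersive hβ y v τ
  -- the two integrands
  set F₁ : E → sphere (0 : E) 1 → ℝ := fun w ω => hardSphereKernel (v, w) ω *
    (|p (collide ω (v, w)).1| * |p (collide ω (v, w)).2| - p v * |p w|) with hF₁
  set F₂ : E → sphere (0 : E) 1 → ℝ := fun w ω => hardSphereKernel (v, w) ω *
    (|q (collide ω (v, w)).1| * |q (collide ω (v, w)).2| - q v * |q w|) with hF₂
  -- measurability of the section integrands
  have hmB : Measurable fun z : E × sphere (0 : E) 1 => hardSphereKernel (v, z.1) z.2 :=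
    (isGradCutoffKernel_hardSphereKernel (E := E)).measurable.comp
      ((measurable_const.prodMk measurable_fst).prodMk measurable_snd)
  have hcc : Continuous fun z : E × sphere (0 : E) 1 => collide z.2 (v, z.1) :=
    continuous_collide_uncurry.comp ((continuous_const.prodMk continuous_fst).prodMk continuous_snd)
  have hm1 : Measurable fun z : E × sphere (0 : E) 1 => (collide z.2 (v, z.1)).1 :=
    hcc.fst.measurable
  have hm2 : Measurable fun z : E × sphere (0 : E) 1 => (collide z.2 (v, z.1)).2 :=
    hcc.snd.measurable
  have habsm : Measurable fun x : ℝ => |x| := continuous_abs.measurable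
  have hF₁m : Measurable (Function.uncurry F₁) :=
    hmB.mul ((((habsm.comp (hpm.comp hm1))).mul (habsm.comp (hpm.comp hm2))).sub
      ((measurable_const.mul (habsm.comp (hpm.comp measurable_fst)))))
  have hF₂m : Measurable (Function.uncurry F₂) :=
    hmB.mul ((((habsm.comp (hqm.comp hm1))).mul (habsm.comp (hqm.comp hm2))).sub
      ((measurable_const.mul (habsm.comp (hqm.comp measurable_fst)))))
  -- pointwise bounds
  have hF₁b : ∀ w ω, |F₁ w ω| ≤ 2 * R ^ 2 * G v * g w := fun w ω => by
    have h := abs_absCollisionIntegrand_le_dispersive hp v w ω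
    simp only [hF₁, hg]
    refine h.trans (le_of_eq ?_)
    ring
  have hF₂b : ∀ w ω, |F₂ w ω| ≤ 2 * R ^ 2 * G v * g w := fun w ω => by
    have h := abs_absCollisionIntegrand_le_dispersive hq v w ω
    simp only [hF₂, hg]
    refine h.trans (le_of_eq ?_)
    ring
  have hF₁₂ : ∀ w ω, |F₁ w ω - F₂ w ω| ≤ 4 * R * D * G v * g w := fun w ω => by
    have h := abs_absCollisionIntegrand_sub_le_dispersive hR hD hp hq hpq v w ω
    simp only [hF₁, hF₂, hg]
    refine h.trans (le_of_eq ?_)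
    ring
  -- integrability
  have hb₁ : Integrable fun w => 2 * R ^ 2 * G v * g w := hgi.const_mul _
  have hb : Integrable fun w => 4 * R * D * G v * g w := hgi.const_mul _
  obtain ⟨hi₁, ho₁⟩ := integrable_inner_outer hF₁m hb₁ hF₁b
  obtain ⟨hi₂, ho₂⟩ := integrable_inner_outer hF₂m hb₁ hF₂b
  have h := abs_integral_integral_sub_le hF₁₂ hb hi₁ hi₂ ho₁ ho₂
  refine h.trans (le_of_eq ?_)
  rw [integral_const_mul]
  simp only [hS, hg]
  ring

/-- **Dispersive bound for the sign-corrected hard-sphere collision operator** (the case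
`q = 0`, `D = R` of `absCollision_lipschitz_dispersive`): for measurable `p` with `|p| ≤ R W`,
`W(u) = e^{-(β/2)(|y - τu|² + |u|²)}`, `β > 0`,
`|Q̃(p)(v)| ≤ 4 |S^{d-1}| R² · W(v) ∫ |v - w| W(w) dw` (CIP 1994 §4.5 (5.1)–(5.5)).
[cite: CIP1994, §4.5 (5.1)–(5.5)] -/
theorem absCollision_bound_dispersive {β : ℝ} (hβ : 0 < β) {y : E} {τ : ℝ}
    {p : E → ℝ} (hpm : Measurable p) {R : ℝ} (hR : 0 ≤ R)
    (hp : ∀ u, |p u| ≤ R * exp (-(β / 2) * (‖y - τ • u‖ ^ 2 + ‖u‖ ^ 2))) (v : E) :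
    |∫ w, ∫ ω, hardSphereKernel (v, w) ω *
        (|p (collide ω (v, w)).1| * |p (collide ω (v, w)).2| - p v * |p w|) ∂sphereMeasure| ≤
      4 * (sphereMeasure : Measure (sphere (0 : E) 1)).real univ * R * R *
        exp (-(β / 2) * (‖y - τ • v‖ ^ 2 + ‖v‖ ^ 2)) *
        ∫ w, ‖v - w‖ * exp (-(β / 2) * (‖y - τ • w‖ ^ 2 + ‖w‖ ^ 2)) := by
  have h0 : ∀ u : E, |(fun _ : E => (0 : ℝ)) u| ≤
      R * exp (-(β / 2) * (‖y - τ • u‖ ^ 2 + ‖u‖ ^ 2)) := fun u => by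
    simp only [abs_zero]; positivity
  have hp0 : ∀ u : E, |p u - (fun _ : E => (0 : ℝ)) u| ≤
      R * exp (-(β / 2) * (‖y - τ • u‖ ^ 2 + ‖u‖ ^ 2)) := fun u => by
    simp only [sub_zero]; exact hp u
  have h := absCollision_lipschitz_dispersive hβ hpm measurable_const hR hR hp h0 hp0 v
  have hI0 : (∫ w, ∫ ω, hardSphereKernel (v, w) ω * (|(fun _ : E => (0 : ℝ)) (collide ω (v, w)).1| *
      |(fun _ : E => (0 : ℝ)) (collide ω (v, w)).2| - (fun _ : E => (0 : ℝ)) v *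
        |(fun _ : E => (0 : ℝ)) w|) ∂sphereMeasure) = 0 := by
    simp
  rw [hI0, sub_zero] at h
  exact h

end Integrated

end

end Literature.MathematicalPhysics.KineticTheory
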